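/-
Copyright (c) 2026. All rights reserved.
Released under Apache 2.0 license as described in the file LICENSE.
Authors: hodgecm-mathlib cell (D-0151), fan A, seat A-p10.
-/
import Literature.NumberTheory.Automorphic.UnitaryGroupIsotropicConeTransitive
import Mathlib.GroupTheory.GroupAction.Quotient
import Mathlib.LinearAlgebra.Matrix.ToLin
import HarnessLib

/-!
# The stabiliser of a non-isotropic vector in `U(σ, H)` is the unitary group of its orthogonal complement, and its orbit is the
# hermitian sphere (orbit–stabiliser for `U(V) ↷ {h(y,y) = h(x,x)}`)

Topic `NumberTheory/Automorphic`; namespace `Literature.NumberTheory.Automorphic.UnitaryGroup` (continues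
`UnitaryGroupHermitianSphereTransitive` ∕ `UnitaryGroupIsotropicConeTransitive`: transitivity of `U(σ,H)` on hermitian spheres
and on the punctured isotropic cone).  KERNEL MATHEMATICS: three small definitions with bodies (`perp`, `perpIsometries`,
`restrictPerp`) and theorems; no named fact, no instance, no `sorry`.

SETTING.  `K` a field with `2 ≠ 0` (where stated), `σ : K →+* K` an involution, `H ∈ Mₙ(K)` `σ`-hermitian, `h = hermForm σ H`,
`U = unitaryGroupOfForm σ H ≤ GLₙ(K)` acting on `Kⁿ` through Mathlib's action of `GLₙ(K) = Mₙ(K)ˣ` (`g • v = g *ᵥ v`);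
`x` a NON-ISOTROPIC vector (`h(x,x) ≠ 0`), `x^⊥ = perp σ H x = {z | h(x,z) = 0}`.

* §1 `perp` and the decomposition `Kⁿ = K x ⊕ x^⊥` (`self_sub_proj_mem_perp`, `eq_proj_add_perpComponent`).
* §2 the stabiliser `Stab_U(x) = MulAction.stabilizer U x` preserves `x^⊥` and RESTRICTS to an isometry of `(x^⊥, h|)`:
  **`restrictPerp σ H x : MulAction.stabilizer U x →* perpIsometries σ H x`** (`perpIsometries` = the isometry group of the
  restricted sesquilinear form, a subgroup of `x^⊥ ≃ₗ[K] x^⊥` — «`U(x^⊥)`»).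
* §3 **`restrictPerp` is INJECTIVE** (`Kⁿ = Kx ⊕ x^⊥`) and **SURJECTIVE** (extend `u ∈ U(x^⊥)` by `x ↦ x`: the block map
  `z ↦ (h(x,z)/h(x,x)) • x + u(z − (h(x,z)/h(x,x)) • x)` is an isometry of `h` fixing `x`), whence
  **`stabilizerEquivPerpIsometries : MulAction.stabilizer U x ≃* perpIsometries σ H x`** — «the stabiliser of a non-isotropic
  vector is the unitary group of its orthogonal complement» ([Dieudonne1971GroupesClassiques, Chap. II §4 n° 6–8]: `x` non
  isotrope ⇒ `E = Kx ⊕ x^⊥`, `U` respecte la décomposition; [Scharlau1985HermitianForms, Ch. 7 §9]).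
* §4 ORBITS: **`orbit_eq_setOf_hermForm_eq`** — `U · x = {y | h(y,y) = h(x,x)}` for `h(x,x) ≠ 0`, `2 ≠ 0` (★ transitivity
  `exists_mem_unitaryGroupOfForm_mulVec_eq`); the orbit–stabiliser bijection onto the sphere
  **`quotientStabilizerEquivSphere : U ⧸ Stab_U(x) ≃ {y // h(y,y) = h(x,x)}`** (Mathlib `MulAction.orbitEquivQuotientStabilizer`);
  and for non-degenerate `H` the all-levels form on non-zero vectors `orbit_eq_setOf_ne_zero_hermForm_eq` (★
  `…_mulVec_eq_of_ne_zero`, isotropic `x` included).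

USE (cell `hodgecm-mathlib`, E-2 child `Cruxes/H413/Lines/F0_E2SiegelWeilWeilRange.lean`, SW2 (i)∕(ii) orbit–stabiliser unfolding,
`stub_SW3_orbit`): `U(b)_v ≃ G_v ∕ Stab` is the bijection along which invariant measures are pulled back (I-UNIQ), and `Stab ≃ U(x^⊥)`
identifies the stabiliser as a unitary group of rank `N−1`.  HC_CM is proved only modulo the printed citations until rung 0 closes.

## References
* [Dieudonne1971GroupesClassiques] J. Dieudonné, *La géométrie des groupes classiques*, 3e éd. (1971), Chap. II §4 n° 6–8.
* [Scharlau1985HermitianForms] W. Scharlau, *Quadratic and Hermitian Forms* (1985), Ch. 7 §9.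
-/

set_option autoImplicit false
noncomputable section

namespace Literature.NumberTheory.Automorphic.UnitaryGroup

open _root_.Matrix

/-! ## §1 The orthogonal complement `x^⊥` and the decomposition `Kⁿ = K x ⊕ x^⊥` -/

section Perp

variable {S : Type*} [CommRing S] (σ : S →+* S) {n : Type*} [Fintype n] [DecidableEq n] (H : Matrix n n S)

/-- **`x^⊥ = {z | h(x, z) = 0}`**, a submodule (`h` is linear in the second variable).
[cite: Dieudonne1971GroupesClassiques, Chap. II §4 n° 6] -/
def perp (x : n → S) : Submodule S (n → S) where
  carrier := {z | hermForm σ H x z = 0}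
  add_mem' {a b} ha hb := by
    simp only [Set.mem_setOf_eq] at ha hb ⊢
    rw [hermForm_add_right, ha, hb, add_zero]
  zero_mem' := hermForm_zero_right σ H x
  smul_mem' c z hz := by
    simp only [Set.mem_setOf_eq] at hz ⊢
    rw [hermForm_smul_right, hz, mul_zero]

/-- membership in `x^⊥`. [cite: Dieudonne1971GroupesClassiques, Chap. II §4 n° 6] -/
@[simp] theorem mem_perp_iff (x z : n → S) : z ∈ perp σ H x ↔ hermForm σ H x z = 0 := Iff.rfl

/-- the action of the subgroup `U(σ, H)` on `Sⁿ` (Mathlib's `Mₙ(S)ˣ`-action): `g • v = g *ᵥ v`. [folklore] -/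
private theorem subgroup_smul_eq_mulVec (g : unitaryGroupOfForm σ H) (v : n → S) :
    g • v = ((g : GL n S) : Matrix n n S) *ᵥ v := rfl

/-- membership in the stabiliser («le sous-groupe laissant fixe `x`»): `g ∈ Stab_U(x) ↔ g x = x`.
[cite: Dieudonne1971GroupesClassiques, Chap. II §4 n° 6] -/
theorem mem_stabilizer_iff (x : n → S) (g : unitaryGroupOfForm σ H) :
    g ∈ MulAction.stabilizer (unitaryGroupOfForm σ H) x ↔ ((g : GL n S) : Matrix n n S) *ᵥ x = x :=
  MulAction.mem_stabilizer_iff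

end Perp

section Field

variable {K : Type*} [Field K] (σ : K →+* K) {n : Type*} [Fintype n] [DecidableEq n] (H : Matrix n n K)

/-- **the projection coefficient on `K x`**: `z − (h(x,z)/h(x,x)) • x ∈ x^⊥` (`h(x,x) ≠ 0`).
[cite: Dieudonne1971GroupesClassiques, Chap. II §4 n° 6] -/
theorem self_sub_proj_mem_perp {x : n → K} (hx : hermForm σ H x x ≠ 0) (z : n → K) :
    z - (hermForm σ H x z / hermForm σ H x x) • x ∈ perp σ H x := by
  rw [mem_perp_iff, hermForm_sub_right, hermForm_smul_right, div_mul_cancel₀ _ hx, sub_self]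

omit [DecidableEq n] in
/-- **`Kⁿ = K x ⊕ x^⊥` (the splitting)**: `z = (h(x,z)/h(x,x)) • x + (z − (h(x,z)/h(x,x)) • x)`, the second summand lying in
`x^⊥` by `self_sub_proj_mem_perp`. [cite: Dieudonne1971GroupesClassiques, Chap. II §4 n° 6] -/
theorem eq_proj_add_perpComponent (x z : n → K) :
    z = (hermForm σ H x z / hermForm σ H x x) • x + (z - (hermForm σ H x z / hermForm σ H x x) • x) := by
  abel

/-! ## §2 The stabiliser restricts to the isometry group of `x^⊥` -/

/-- **the isometry group of the restricted form on `x^⊥`** («`U(x^⊥)`»): the `u : x^⊥ ≃ₗ[K] x^⊥` with `h(u v, u w) = h(v, w)`.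
[cite: Dieudonne1971GroupesClassiques, Chap. II §4 n° 6] -/
def perpIsometries (x : n → K) : Subgroup (perp σ H x ≃ₗ[K] perp σ H x) where
  carrier := {u | ∀ v w : perp σ H x, hermForm σ H (u v : n → K) (u w : n → K) = hermForm σ H (v : n → K) (w : n → K)}
  mul_mem' {u u'} hu hu' v w := by
    simp only [Set.mem_setOf_eq] at hu hu'
    rw [LinearEquiv.mul_apply, LinearEquiv.mul_apply, hu, hu']
  one_mem' v w := rfl
  inv_mem' {u} hu v w := by
    simp only [Set.mem_setOf_eq] at hu
    have h := hu (u⁻¹ v) (u⁻¹ w)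
    simp only [LinearEquiv.coe_inv, LinearEquiv.apply_symm_apply] at h
    simpa only [LinearEquiv.coe_inv] using h.symm

/-- membership in `perpIsometries`. [cite: Dieudonne1971GroupesClassiques, Chap. II §4 n° 6] -/
@[simp] theorem mem_perpIsometries_iff (x : n → K) (u : perp σ H x ≃ₗ[K] perp σ H x) :
    u ∈ perpIsometries σ H x ↔
      ∀ v w : perp σ H x, hermForm σ H (u v : n → K) (u w : n → K) = hermForm σ H (v : n → K) (w : n → K) :=
  Iff.rfl

/-- an isometry of `h` fixing `x` maps `x^⊥` into `x^⊥`. [cite: Dieudonne1971GroupesClassiques, Chap. II §4 n° 6] -/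
theorem mulVec_mem_perp_of_mem_stabilizer {x : n → K} {g : unitaryGroupOfForm σ H}
    (hg : g ∈ MulAction.stabilizer (unitaryGroupOfForm σ H) x) {z : n → K} (hz : z ∈ perp σ H x) :
    ((g : GL n K) : Matrix n n K) *ᵥ z ∈ perp σ H x := by
  rw [mem_stabilizer_iff] at hg
  rw [mem_perp_iff] at hz ⊢
  have hiso := (mem_unitaryGroupOfForm_iff_hermForm σ H (g : GL n K)).1 g.2 x z
  rw [hg] at hiso
  rw [hiso, hz]

/-- the restriction of a stabilising isometry to `x^⊥`, as a linear map. [cite: Dieudonne1971GroupesClassiques, Chap. II §4 n° 6] -/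
private def restrictLin {x : n → K} (g : unitaryGroupOfForm σ H) (hg : g ∈ MulAction.stabilizer (unitaryGroupOfForm σ H) x) :
    perp σ H x →ₗ[K] perp σ H x :=
  (Matrix.mulVecLin ((g : GL n K) : Matrix n n K)).restrict fun _ hz => mulVec_mem_perp_of_mem_stabilizer σ H hg hz

/-- value of the restriction. [folklore] -/
private theorem coe_restrictLin_apply {x : n → K} (g : unitaryGroupOfForm σ H)
    (hg : g ∈ MulAction.stabilizer (unitaryGroupOfForm σ H) x) (z : perp σ H x) :
    (restrictLin σ H g hg z : n → K) = ((g : GL n K) : Matrix n n K) *ᵥ (z : n → K) := rfl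

/-- the inverse of a stabilising element stabilises. [folklore] -/
private theorem inv_mem_stabilizer {x : n → K} {g : unitaryGroupOfForm σ H}
    (hg : g ∈ MulAction.stabilizer (unitaryGroupOfForm σ H) x) : g⁻¹ ∈ MulAction.stabilizer (unitaryGroupOfForm σ H) x :=
  (MulAction.stabilizer (unitaryGroupOfForm σ H) x).inv_mem hg

/-- the restriction as a linear AUTOMORPHISM of `x^⊥` (inverse: the restriction of `g⁻¹`). [cite: Dieudonne1971GroupesClassiques, Chap. II §4 n° 6] -/
private def restrictEquiv {x : n → K} (g : unitaryGroupOfForm σ H)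
    (hg : g ∈ MulAction.stabilizer (unitaryGroupOfForm σ H) x) : perp σ H x ≃ₗ[K] perp σ H x :=
  LinearEquiv.ofLinear (restrictLin σ H g hg) (restrictLin σ H g⁻¹ (inv_mem_stabilizer σ H hg))
    (by
      refine LinearMap.ext fun z => Subtype.ext ?_
      change ((g : GL n K) : Matrix n n K) *ᵥ ((((g⁻¹ : unitaryGroupOfForm σ H) : GL n K) : Matrix n n K) *ᵥ (z : n → K)) = z
      rw [Matrix.mulVec_mulVec, Subgroup.coe_inv, ← Units.val_mul, mul_inv_cancel, Units.val_one, Matrix.one_mulVec])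
    (by
      refine LinearMap.ext fun z => Subtype.ext ?_
      change ((((g⁻¹ : unitaryGroupOfForm σ H) : GL n K) : Matrix n n K)) *ᵥ (((g : GL n K) : Matrix n n K) *ᵥ (z : n → K)) = z
      rw [Matrix.mulVec_mulVec, Subgroup.coe_inv, ← Units.val_mul, inv_mul_cancel, Units.val_one, Matrix.one_mulVec])

/-- value of `restrictEquiv`. [folklore] -/
private theorem coe_restrictEquiv_apply {x : n → K} (g : unitaryGroupOfForm σ H)
    (hg : g ∈ MulAction.stabilizer (unitaryGroupOfForm σ H) x) (z : perp σ H x) :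
    (restrictEquiv σ H g hg z : n → K) = ((g : GL n K) : Matrix n n K) *ᵥ (z : n → K) := rfl

/-- **the restriction homomorphism `Stab_U(x) →* U(x^⊥)`**, `g ↦ g|_{x^⊥}`. [cite: Dieudonne1971GroupesClassiques, Chap. II §4 n° 6] -/
def restrictPerp (x : n → K) : MulAction.stabilizer (unitaryGroupOfForm σ H) x →* perpIsometries σ H x where
  toFun g := ⟨restrictEquiv σ H (g : unitaryGroupOfForm σ H) g.2, fun v w => by
    rw [coe_restrictEquiv_apply, coe_restrictEquiv_apply]
    exact (mem_unitaryGroupOfForm_iff_hermForm σ H _).1 (g : unitaryGroupOfForm σ H).2 _ _⟩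
  map_one' := by
    refine Subtype.ext (LinearEquiv.ext fun z => Subtype.ext ?_)
    change (((((1 : MulAction.stabilizer (unitaryGroupOfForm σ H) x) : unitaryGroupOfForm σ H) : GL n K) : Matrix n n K)) *ᵥ
      (z : n → K) = z
    rw [OneMemClass.coe_one, OneMemClass.coe_one, Units.val_one, Matrix.one_mulVec]
  map_mul' g g' := by
    refine Subtype.ext (LinearEquiv.ext fun z => Subtype.ext ?_)
    change (((((g * g' : MulAction.stabilizer (unitaryGroupOfForm σ H) x) : unitaryGroupOfForm σ H) : GL n K) : Matrix n n K))
        *ᵥ (z : n → K) =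
      (((g : unitaryGroupOfForm σ H) : GL n K) : Matrix n n K) *ᵥ
        ((((g' : unitaryGroupOfForm σ H) : GL n K) : Matrix n n K) *ᵥ (z : n → K))
    rw [Matrix.mulVec_mulVec, Subgroup.coe_mul, Subgroup.coe_mul, Units.val_mul]

/-- value of `restrictPerp`: `(g|_{x^⊥}) z = g z`. [cite: Dieudonne1971GroupesClassiques, Chap. II §4 n° 6] -/
@[simp] theorem coe_restrictPerp_apply (x : n → K) (g : MulAction.stabilizer (unitaryGroupOfForm σ H) x) (z : perp σ H x) :
    (((restrictPerp σ H x g : perpIsometries σ H x) : perp σ H x ≃ₗ[K] perp σ H x) z : n → K) =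
      ((((g : unitaryGroupOfForm σ H) : GL n K) : Matrix n n K)) *ᵥ (z : n → K) := rfl

/-! ## §3 `Stab_U(x) ≃* U(x^⊥)` for `x` non-isotropic -/

/-- **injectivity**: an isometry fixing `x` and every vector of `x^⊥` is the identity (`Kⁿ = Kx ⊕ x^⊥`, `h(x,x) ≠ 0`).
[cite: Dieudonne1971GroupesClassiques, Chap. II §4 n° 6] -/
theorem restrictPerp_injective {x : n → K} (hx : hermForm σ H x x ≠ 0) : Function.Injective (restrictPerp σ H x) := by
  refine (injective_iff_map_eq_one _).2 fun g hg => ?_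
  have hgx : ((((g : unitaryGroupOfForm σ H) : GL n K) : Matrix n n K)) *ᵥ x = x := (mem_stabilizer_iff σ H x _).1 g.2
  have hperp : ∀ z ∈ perp σ H x, ((((g : unitaryGroupOfForm σ H) : GL n K) : Matrix n n K)) *ᵥ z = z := fun z hz => by
    have h := congrArg (fun u : perpIsometries σ H x => ((u : perp σ H x ≃ₗ[K] perp σ H x) ⟨z, hz⟩ : n → K)) hg
    simpa only [coe_restrictPerp_apply, OneMemClass.coe_one, LinearEquiv.coe_one, id_eq] using h
  refine Subtype.ext (Subtype.ext (Units.ext (Matrix.ext_iff_mulVec.2 fun z => ?_)))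
  rw [OneMemClass.coe_one, OneMemClass.coe_one, Units.val_one, Matrix.one_mulVec]
  set c : K := hermForm σ H x z / hermForm σ H x x
  have hz := eq_proj_add_perpComponent σ H x z
  conv_lhs => rw [hz]
  conv_rhs => rw [hz]
  rw [Matrix.mulVec_add, Matrix.mulVec_smul, hgx, hperp _ (self_sub_proj_mem_perp σ H hx z)]

/-- the block extension of `u ∈ U(x^⊥)` by `x ↦ x`, as a linear map
`z ↦ (h(x,z)/h(x,x)) • x + u(z − (h(x,z)/h(x,x)) • x)`. [cite: Dieudonne1971GroupesClassiques, Chap. II §4 n° 6] -/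
private def extendLin {x : n → K} (hx : hermForm σ H x x ≠ 0) (u : perp σ H x ≃ₗ[K] perp σ H x) : (n → K) →ₗ[K] (n → K) where
  toFun z := (hermForm σ H x z / hermForm σ H x x) • x + (u ⟨z - (hermForm σ H x z / hermForm σ H x x) • x,
    self_sub_proj_mem_perp σ H hx z⟩ : n → K)
  map_add' z w := by
    have hmem : (⟨z + w - (hermForm σ H x (z + w) / hermForm σ H x x) • x, self_sub_proj_mem_perp σ H hx (z + w)⟩ :
        perp σ H x) =
        ⟨z - (hermForm σ H x z / hermForm σ H x x) • x, self_sub_proj_mem_perp σ H hx z⟩ +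
          ⟨w - (hermForm σ H x w / hermForm σ H x x) • x, self_sub_proj_mem_perp σ H hx w⟩ := by
      refine Subtype.ext ?_
      simp only [Submodule.coe_add, hermForm_add_right, add_div, add_smul]
      abel
    rw [hmem, map_add, Submodule.coe_add, hermForm_add_right, add_div, add_smul]
    abel
  map_smul' a z := by
    have hmem : (⟨a • z - (hermForm σ H x (a • z) / hermForm σ H x x) • x, self_sub_proj_mem_perp σ H hx (a • z)⟩ :
        perp σ H x) = a • ⟨z - (hermForm σ H x z / hermForm σ H x x) • x, self_sub_proj_mem_perp σ H hx z⟩ := by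
      refine Subtype.ext ?_
      simp only [Submodule.coe_smul, hermForm_smul_right, mul_div_assoc, smul_sub, smul_smul]
    rw [hmem, map_smul, Submodule.coe_smul, hermForm_smul_right, mul_div_assoc, RingHom.id_apply, smul_add, smul_smul]

/-- value of `extendLin`. [folklore] -/
private theorem extendLin_apply {x : n → K} (hx : hermForm σ H x x ≠ 0) (u : perp σ H x ≃ₗ[K] perp σ H x) (z : n → K) :
    extendLin σ H hx u z = (hermForm σ H x z / hermForm σ H x x) • x +
      (u ⟨z - (hermForm σ H x z / hermForm σ H x x) • x, self_sub_proj_mem_perp σ H hx z⟩ : n → K) := rfl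

/-- `extendLin u` fixes `x`. [folklore] -/
private theorem extendLin_self {x : n → K} (hx : hermForm σ H x x ≠ 0) (u : perp σ H x ≃ₗ[K] perp σ H x) :
    extendLin σ H hx u x = x := by
  have h0 : (⟨x - (hermForm σ H x x / hermForm σ H x x) • x, self_sub_proj_mem_perp σ H hx x⟩ : perp σ H x) = 0 := by
    refine Subtype.ext ?_
    simp only [div_self hx, one_smul, sub_self, Submodule.coe_zero]
  rw [extendLin_apply, h0, map_zero, Submodule.coe_zero, add_zero, div_self hx, one_smul]

/-- `extendLin u` restricts to `u` on `x^⊥`. [folklore] -/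
private theorem extendLin_of_mem {x : n → K} (hx : hermForm σ H x x ≠ 0) (u : perp σ H x ≃ₗ[K] perp σ H x) (z : perp σ H x) :
    extendLin σ H hx u z = (u z : n → K) := by
  have hz : hermForm σ H x z = 0 := z.2
  have h1 : (⟨(z : n → K) - (hermForm σ H x z / hermForm σ H x x) • x, self_sub_proj_mem_perp σ H hx z⟩ : perp σ H x) = z := by
    refine Subtype.ext ?_
    simp only [hz, zero_div, zero_smul, sub_zero]
  rw [extendLin_apply, h1, hz, zero_div, zero_smul, zero_add]

/-- the `x`-coefficient and the `x^⊥`-component of `extendLin u z`. [folklore] -/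
private theorem hermForm_left_extendLin {x : n → K} (hx : hermForm σ H x x ≠ 0) (u : perp σ H x ≃ₗ[K] perp σ H x)
    (z : n → K) : hermForm σ H x (extendLin σ H hx u z) = hermForm σ H x z := by
  have hu : hermForm σ H x (u ⟨z - (hermForm σ H x z / hermForm σ H x x) • x, self_sub_proj_mem_perp σ H hx z⟩ : n → K) = 0 :=
    (u _).2
  rw [extendLin_apply, hermForm_add_right, hermForm_smul_right, hu, add_zero, div_mul_cancel₀ _ hx]

/-- `extendLin u⁻¹ ∘ extendLin u = id`. [folklore] -/
private theorem extendLin_symm_comp {x : n → K} (hx : hermForm σ H x x ≠ 0) (u : perp σ H x ≃ₗ[K] perp σ H x) (z : n → K) :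
    extendLin σ H hx u.symm (extendLin σ H hx u z) = z := by
  have hc : hermForm σ H x (extendLin σ H hx u z) / hermForm σ H x x = hermForm σ H x z / hermForm σ H x x := by
    rw [hermForm_left_extendLin]
  have hp : (⟨extendLin σ H hx u z - (hermForm σ H x (extendLin σ H hx u z) / hermForm σ H x x) • x,
      self_sub_proj_mem_perp σ H hx _⟩ : perp σ H x) =
      u ⟨z - (hermForm σ H x z / hermForm σ H x x) • x, self_sub_proj_mem_perp σ H hx z⟩ := by
    refine Subtype.ext ?_
    change extendLin σ H hx u z - (hermForm σ H x (extendLin σ H hx u z) / hermForm σ H x x) • x = _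
    rw [hc, extendLin_apply, add_sub_cancel_left]
  rw [extendLin_apply σ H hx u.symm, hp, LinearEquiv.symm_apply_apply, hc]
  exact (eq_proj_add_perpComponent σ H x z).symm

/-- the block extension as a unit of `Mₙ(K)`. [cite: Dieudonne1971GroupesClassiques, Chap. II §4 n° 6] -/
private def extendGL {x : n → K} (hx : hermForm σ H x x ≠ 0) (u : perp σ H x ≃ₗ[K] perp σ H x) : GL n K where
  val := LinearMap.toMatrix' (extendLin σ H hx u)
  inv := LinearMap.toMatrix' (extendLin σ H hx u.symm)
  val_inv := by
    rw [← LinearMap.toMatrix'_comp, ← LinearMap.toMatrix'_id]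
    congr 1
    refine LinearMap.ext fun z => ?_
    have h := extendLin_symm_comp σ H hx u.symm z
    rw [LinearEquiv.symm_symm] at h
    exact h
  inv_val := by
    rw [← LinearMap.toMatrix'_comp, ← LinearMap.toMatrix'_id]
    congr 1
    exact LinearMap.ext fun z => extendLin_symm_comp σ H hx u z

/-- action of `extendGL`. [folklore] -/
private theorem extendGL_mulVec {x : n → K} (hx : hermForm σ H x x ≠ 0) (u : perp σ H x ≃ₗ[K] perp σ H x) (z : n → K) :
    ((extendGL σ H hx u : GL n K) : Matrix n n K) *ᵥ z = extendLin σ H hx u z :=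
  LinearMap.toMatrix'_mulVec _ _

/-- **the block extension is an isometry of `h`** when `u ∈ U(x^⊥)`: cross terms vanish and `h|_{x^⊥}` is preserved.
[cite: Dieudonne1971GroupesClassiques, Chap. II §4 n° 6] -/
private theorem extendGL_mem {x : n → K} (hσ : ∀ s, σ (σ s) = s) (hH : (H.map σ)ᵀ = H) (hx : hermForm σ H x x ≠ 0)
    {u : perp σ H x ≃ₗ[K] perp σ H x} (hu : u ∈ perpIsometries σ H x) : extendGL σ H hx u ∈ unitaryGroupOfForm σ H := by
  rw [mem_unitaryGroupOfForm_iff_hermForm]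
  intro v w
  rw [extendGL_mulVec, extendGL_mulVec]
  -- expand both sides along `Kx ⊕ x^⊥`
  set cv : K := hermForm σ H x v / hermForm σ H x x
  set cw : K := hermForm σ H x w / hermForm σ H x x
  set pv : perp σ H x := ⟨v - cv • x, self_sub_proj_mem_perp σ H hx v⟩
  set pw : perp σ H x := ⟨w - cw • x, self_sub_proj_mem_perp σ H hx w⟩
  have hv : v = cv • x + (pv : n → K) := eq_proj_add_perpComponent σ H x v
  have hw : w = cw • x + (pw : n → K) := eq_proj_add_perpComponent σ H x w
  -- cross terms: `h(x, p) = 0` and `h(p, x) = 0` for `p ∈ x^⊥`, and the same for `u p`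
  have hxp : ∀ p : perp σ H x, hermForm σ H x (p : n → K) = 0 := fun p => p.2
  have hpx : ∀ p : perp σ H x, hermForm σ H (p : n → K) x = 0 := fun p => by
    rw [← conj_hermForm σ H hσ hH, hxp p, map_zero]
  have key : ∀ (a b : K) (p q : n → K), hermForm σ H x p = 0 → hermForm σ H p x = 0 → hermForm σ H x q = 0 →
      hermForm σ H q x = 0 →
      hermForm σ H (a • x + p) (b • x + q) = σ a * b * hermForm σ H x x + hermForm σ H p q := by
    intro a b p q hxp' hpx' hxq' hqx'
    simp only [hermForm_add_left, hermForm_add_right, hermForm_smul_left_eq, hermForm_smul_right, hxq', hpx', mul_zero, add_zero,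
      zero_add]
    ring
  rw [extendLin_apply, extendLin_apply, key cv cw _ _ (hxp _) (hpx _) (hxp _) (hpx _), hu pv pw]
  conv_rhs => rw [hv, hw]
  rw [key cv cw _ _ (hxp _) (hpx _) (hxp _) (hpx _)]

/-- **surjectivity**: every isometry of `(x^⊥, h|)` is the restriction of an element of the stabiliser (its block extension by
`x ↦ x`). [cite: Dieudonne1971GroupesClassiques, Chap. II §4 n° 6] -/
theorem restrictPerp_surjective (hσ : ∀ s, σ (σ s) = s) (hH : (H.map σ)ᵀ = H) {x : n → K} (hx : hermForm σ H x x ≠ 0) :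
    Function.Surjective (restrictPerp σ H x) := by
  intro u
  have hmem : extendGL σ H hx (u : perp σ H x ≃ₗ[K] perp σ H x) ∈ unitaryGroupOfForm σ H := extendGL_mem σ H hσ hH hx u.2
  have hstab : (⟨extendGL σ H hx (u : perp σ H x ≃ₗ[K] perp σ H x), hmem⟩ : unitaryGroupOfForm σ H) ∈
      MulAction.stabilizer (unitaryGroupOfForm σ H) x := by
    rw [mem_stabilizer_iff, Subgroup.coe_mk, extendGL_mulVec, extendLin_self]
  refine ⟨⟨_, hstab⟩, Subtype.ext (LinearEquiv.ext fun z => Subtype.ext ?_)⟩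
  rw [coe_restrictPerp_apply]
  change ((extendGL σ H hx (u : perp σ H x ≃ₗ[K] perp σ H x) : GL n K) : Matrix n n K) *ᵥ (z : n → K) = _
  rw [extendGL_mulVec, extendLin_of_mem]

/-- **`Stab_{U(σ,H)}(x) ≃* U(x^⊥)` for a non-isotropic `x`**: the stabiliser of a non-isotropic vector in the unitary group is
the unitary group of its orthogonal complement, via restriction. [cite: Dieudonne1971GroupesClassiques, Chap. II §4 n° 6–8]
[cite: Scharlau1985HermitianForms, Ch. 7 §9] -/
def stabilizerEquivPerpIsometries (hσ : ∀ s, σ (σ s) = s) (hH : (H.map σ)ᵀ = H) {x : n → K} (hx : hermForm σ H x x ≠ 0) :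
    MulAction.stabilizer (unitaryGroupOfForm σ H) x ≃* perpIsometries σ H x :=
  MulEquiv.ofBijective (restrictPerp σ H x) ⟨restrictPerp_injective σ H hx, restrictPerp_surjective σ H hσ hH hx⟩

/-- value of the isomorphism: `(stabilizerEquivPerpIsometries g) z = g z`. [cite: Dieudonne1971GroupesClassiques, Chap. II §4 n° 6] -/
@[simp] theorem coe_stabilizerEquivPerpIsometries_apply (hσ : ∀ s, σ (σ s) = s) (hH : (H.map σ)ᵀ = H) {x : n → K}
    (hx : hermForm σ H x x ≠ 0) (g : MulAction.stabilizer (unitaryGroupOfForm σ H) x) (z : perp σ H x) :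
    (((stabilizerEquivPerpIsometries σ H hσ hH hx g : perpIsometries σ H x) : perp σ H x ≃ₗ[K] perp σ H x) z : n → K) =
      ((((g : unitaryGroupOfForm σ H) : GL n K) : Matrix n n K)) *ᵥ (z : n → K) := rfl

/-! ## §4 Orbits: the hermitian sphere, and orbit–stabiliser -/

/-- **the orbit of a non-isotropic vector is its hermitian sphere**: `U(σ,H) · x = {y | h(y,y) = h(x,x)}` (`2 ≠ 0`; ★
transitivity `exists_mem_unitaryGroupOfForm_mulVec_eq`). [cite: Dieudonne1971GroupesClassiques, Chap. II §4 n° 7–8]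
[cite: Scharlau1985HermitianForms, Ch. 7 §9] -/
theorem orbit_eq_setOf_hermForm_eq (h2 : (2 : K) ≠ 0) (hσ : ∀ s, σ (σ s) = s) (hH : (H.map σ)ᵀ = H) {x : n → K}
    (hx : hermForm σ H x x ≠ 0) :
    MulAction.orbit (unitaryGroupOfForm σ H) x = {y | hermForm σ H y y = hermForm σ H x x} := by
  ext y
  rw [MulAction.mem_orbit_iff, Set.mem_setOf_eq]
  constructor
  · rintro ⟨g, rfl⟩
    rw [subgroup_smul_eq_mulVec]
    exact (mem_unitaryGroupOfForm_iff_hermForm σ H (g : GL n K)).1 g.2 x x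
  · intro hy
    obtain ⟨g, hg, hgx⟩ := exists_mem_unitaryGroupOfForm_mulVec_eq σ H hσ hH h2 rfl hy hx
    exact ⟨⟨g, hg⟩, hgx⟩

/-- **orbit–stabiliser onto the sphere**: `U(σ,H) ⧸ Stab_U(x) ≃ {y // h(y,y) = h(x,x)}` for `x` non-isotropic
(Mathlib `MulAction.orbitEquivQuotientStabilizer` + `orbit_eq_setOf_hermForm_eq`). [cite: Dieudonne1971GroupesClassiques, Chap. II §4 n° 7–8] -/
def quotientStabilizerEquivSphere (h2 : (2 : K) ≠ 0) (hσ : ∀ s, σ (σ s) = s) (hH : (H.map σ)ᵀ = H) {x : n → K}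
    (hx : hermForm σ H x x ≠ 0) :
    unitaryGroupOfForm σ H ⧸ MulAction.stabilizer (unitaryGroupOfForm σ H) x ≃ {y : n → K // hermForm σ H y y = hermForm σ H x x} :=
  (MulAction.orbitEquivQuotientStabilizer (unitaryGroupOfForm σ H) x).symm.trans
    (Equiv.setCongr (orbit_eq_setOf_hermForm_eq σ H h2 hσ hH hx))

/-- **all-levels orbit on non-zero vectors** for a NON-DEGENERATE `H`: `U(σ,H) · x = {y ≠ 0 | h(y,y) = h(x,x)}` for every
`x ≠ 0` (isotropic included; ★ `exists_mem_unitaryGroupOfForm_mulVec_eq_of_ne_zero`).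
[cite: Dieudonne1971GroupesClassiques, Chap. II §4 n° 7–8] [cite: Scharlau1985HermitianForms, Ch. 7 §9] -/
theorem orbit_eq_setOf_ne_zero_hermForm_eq (h2 : (2 : K) ≠ 0) (hσ : ∀ s, σ (σ s) = s) (hH : (H.map σ)ᵀ = H)
    (hHd : H.det ≠ 0) {x : n → K} (hx0 : x ≠ 0) :
    MulAction.orbit (unitaryGroupOfForm σ H) x = {y | y ≠ 0 ∧ hermForm σ H y y = hermForm σ H x x} := by
  ext y
  rw [MulAction.mem_orbit_iff, Set.mem_setOf_eq]
  constructor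
  · rintro ⟨g, rfl⟩
    rw [subgroup_smul_eq_mulVec]
    refine ⟨fun h0 => hx0 ?_, (mem_unitaryGroupOfForm_iff_hermForm σ H (g : GL n K)).1 g.2 x x⟩
    have h := congrArg (fun v => (((g : GL n K)⁻¹ : GL n K) : Matrix n n K) *ᵥ v) h0
    simpa only [Matrix.mulVec_mulVec, ← Units.val_mul, inv_mul_cancel, Units.val_one, Matrix.one_mulVec,
      Matrix.mulVec_zero] using h
  · rintro ⟨hy0, hy⟩
    obtain ⟨g, hg, hgx⟩ := exists_mem_unitaryGroupOfForm_mulVec_eq_of_ne_zero σ H h2 hσ hH hHd hx0 hy0 hy.symm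
    exact ⟨⟨g, hg⟩, hgx⟩

end Field

end Literature.NumberTheory.Automorphic.UnitaryGroup
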